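/-
Copyright (c) 2026 the pub-hodgecm-mathlib formalisation cell (harness21).  Prover seat hodgecm-mathlib-LH4-p15 (g0), req620 Track A «(D-RAM) FOUR-FRAME» squad
(STAGE-1b, row (2) of the piece `f_{T₊}`, the (β₂) road under heir LEAD F0P3a-plan (g21) T20-18 (R-36) «PURE-CELL LEDGER»; sub-dealer LH4-p04 (g8) β₂-BOARD v1 da0f832c
§0 currency `hum : |u₀₀ − 1| ≤ |ϖ^m|`; dedup with LH4-p16 (g0) 15:21:24Z: the depth-form letter is ★ p861311, this file is the EXCHANGE on top of it), 2026-09-04.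
-/
import Summits.HodgeConjecture.HodgeConjecture.Theorems.F0P3cDyRamGlueValueDepthForm   -- ★ p861311 (LH4-p16 (g0)) «THE DEPTH-FORM LETTER»: `valueSet_endoGL_sub_one_glued_map_eq_image_mul_of_v_sub_one_le`, `latticeValueSetMod_glued_map_eq_image_mul_of_v_sub_one_le`
import Summits.HodgeConjecture.HodgeConjecture.Theorems.F0P3cDyRamConeCellFaceAxis      -- ★ p861154 (this seat): `image_mul_eq_valueSetMod_minus_of_eq_plus ∕ …_plus_of_eq_minus`, `latticeValueSetMod_eq_minus_of_latticeLabelPlus_of_eq_image`, `latticeLabelPlus_of_…`, `latticeLabelPlus_iff_not_of_eq_image`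
import HarnessLib

/-!
# Crux `H413`, line LH4 «(D-RAM) FOUR-FRAME» — STAGE-1b, row (2), the (β₂) road (R-36): «THE FACE NEAR 1 ON EVERY CELL» — under `|u₀₀ − 1| ≤ |ϖ^m|` a `γ₂`-commuting similitude
# whose multiplier is a `σ`-fixed NON-norm unit EXCHANGES the label classes `+ ↔ −′` between the integral glued vertices over `(B₂, w₀)` and `(ε·B₂, ε·w₀)`

Cell `hodgecm-mathlib` (D-0151), FLOOR 0, crux item H413 = `stmt-HodgeConjecture-24833`, route of record `HCCMUnconditional`; squad F0∕P3c∕LH4; lane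
`--supports stmt-HodgeConjecture-24833 --as helper` (count-neutral; pays NO tier-0 row).  THEOREMS ONLY (no `def`, no instance, no notation, no `sorry`, default heartbeats);
★-only imports; states NO law; (β₂) stays a HYPOTHESIS.

WHY.  ★ p861311 (LH4-p16 (g0)) «DEPTH-FORM LETTER»: under the β₂-BOARD's `hum : |u₀₀ − 1| ≤ |ϖ^m|` and integrality, the thickened value set of `Γ − 1` on a glued vertex is that of
the single depth form `β′ ↦ ⟨β′, (γ₂ − u)β′⟩_{H₂}` on `B₂ + 𝒪·w₀`, so a `γ₂`-commuting similitude `ε` of unit multiplier `ξ` MULTIPLIES THE LETTER BY `ξ` on EVERY cone cell (axis or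
tube, below or above the conductor) — ★ p861069's scaling without `hline`.  ★ p861154 (this seat) §2: multiplying a value set by a `σ`-fixed NON-norm unit exchanges the classes
`VS_m(X₊)` (`+`) and `VS_m(c • X₊)` (`−′`, `c` a fixed non-norm unit) — every level `m`, no dichotomy.  THIS FILE composes the two (the dedup cut agreed with LH4-p16 (g0) 15:21Z):
* §1 `valueSet_glued_exchange_of_near_one` — general block form `(H₂, h)` (the `VS_H` letters of β₂-BOARD §0): `VS_H(M) = VS_m(X₊) → VS_H(M′) = VS_m(c • X₊)` and
  `VS_H(M) = VS_m(c • X₊) → VS_H(M′) = VS_m(X₊)`.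
* §2 `latticeLabel_exchange_of_near_one` — census letters (`Φ₃ = block(antidiag₂, 1)`): `LatticeLabelPlus M (Γ − 1) → latticeValueSetMod M′ (Γ − 1) = VS_m(c • X₊)` and
  `latticeValueSetMod M (Γ − 1) = VS_m(c • X₊) → LatticeLabelPlus M′ (Γ − 1)`; `latticeLabelPlus_iff_not_of_near_one` — the one-label form `LabelPlus M′ ↔ ¬ LabelPlus M` at the
  level of record `m* = mstarOfRecord d` given an (A″) witness at `M` (★ p860337 on the clean shell).
USE ((L-P) LH7-p09, (L-D) LH7-p10 ∕ LH4-p09, (L-S1)(L-S2) this seat, (L-K0) LH4-p16, (S4) LH4-p04): with cell preservation ★ p860839 and a cell-∕populatedness-preserving admissible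
`ε` of non-norm multiplier, ★ p861154 §4 `ncard_levelSet[Dep]_…_of_valueSet_dictionary` turn these into `cellDiff_t(j,b) = 0`; where NO such `ε` exists the cell may be PURE (the ledger rows).
HONEST LABEL.  Count-neutral; nothing printed is asserted; no census law is stated; which cells carry an admissible populatedness-preserving non-norm flip is NOT claimed;
`HC_CM` is proved only modulo the 7 printed citations (2 remaining named inputs: hLiu418 = `stmt-HodgeConjecture-24832`, h413 = `stmt-HodgeConjecture-24833`) until rung 0 closes.
## References
* [Serre1979] J.-P. Serre, *Local Fields*, GTM 67 (1979): Ch. V §3 Cor. 3 (norm classes of units: index two).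
* [Rogawski1990] J. D. Rogawski, *Automorphic Representations of Unitary Groups in Three Variables*, Ann. of Math. Stud. 123 (1990): §4.9 Prop. 4.9.1 (b) p. 55 (the labelled census of `f_{T₊}`).
* [Jacobowitz1962] R. Jacobowitz, *Hermitian forms over local fields*, Amer. J. Math. 84 (1962): §4 (similitudes, dual lattices, gluing).
* [Kottwitz1986BaseChangeUnits] R. E. Kottwitz, *Base change for unit elements of Hecke algebras*, Compositio Math. 60 (1986): §1 pp. 240–241.
-/

set_option autoImplicit false

noncomputable section

namespace Summit.HodgeConjecture.HodgeConjecture.Cruxes.H413.F0P3cDyRamGlueLabelExchangeNearOne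

open scoped Valued WithZero Matrix MatrixGroups
open WithZero
open Literature.NumberTheory.Automorphic Literature.NumberTheory.Automorphic.HermitianLattice Literature.NumberTheory.Automorphic.UnitaryLatticeTree
open Literature.NumberTheory.Automorphic.UnitaryThreeFourFrame (IsRamifiedQuadraticDatum)
open Literature.NumberTheory.Rogawski1990
open Summit.HodgeConjecture.HodgeConjecture.Cruxes.H413.F0P3cDyRamFourFramePieces
open Summit.HodgeConjecture.HodgeConjecture.Cruxes.H413.F0P3cDyRamFourFrameCensusDefs (latticeValueSetMod LatticeLabelPlus)
open Summit.HodgeConjecture.HodgeConjecture.Cruxes.H413.F0P3cDyRamGlueValueDepthForm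
open Summit.HodgeConjecture.HodgeConjecture.Cruxes.H413.F0P3cDyRamConeCellFaceAxis

variable {K : Type} [Field K] [Valued K ℤᵐ⁰] {σ : K →+* K} {ϖ : K} {d t : ℕ}

/-! ## §1 General block form `(H₂, h)`: the `VS_H` letters of the β₂-BOARD -/

/-- **THE FACE NEAR 1, GENERAL BLOCK FORM.**  At a complete sheet datum on `K`: two INTEGRAL glued vertices `M` (over `(B₂, w₀, x₀)`) and `M′` (over `(ε·B₂, ε·w₀, x₀′)`), same tube `b`,
of the same `Γ = endoGL (γ₂, u)` with `|u₀₀ − 1| ≤ |ϖ^m|`; `ε` a `γ₂`-commuting similitude of `(K², H₂)` whose multiplier `ξ` is a `σ`-FIXED NON-NORM unit; `c` a `σ`-fixed non-norm unit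
(the `−′` class).  Then the thickened value sets `VS_H` of `Γ − 1` satisfy `VS_H(M) = VS_m(X₊) → VS_H(M′) = VS_m(c • X₊)` and `VS_H(M) = VS_m(c • X₊) → VS_H(M′) = VS_m(X₊)`
(★ p861311 scaling ∘ ★ p861154 §2). [cite: Serre1979, Ch. V §3 Cor. 3] [cite: Rogawski1990, §4.9 Prop. 4.9.1 (b) p. 55] [cite: Jacobowitz1962, §4] -/
theorem valueSet_glued_exchange_of_near_one [CompleteSpace K] [Finite 𝓀[K]] (hD : IsRamifiedQuadraticDatum σ ϖ d t) (H₂ : Matrix (Fin 2) (Fin 2) K) (h : K)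
    {M M' : Submodule 𝒪[K] (Fin 3 → K)} {b : ℕ} (hpr : ∀ x ∈ M, Valued.v (x 1) * Valued.v ϖ ^ b ≤ 1) (hpr' : ∀ x ∈ M', Valued.v (x 1) * Valued.v ϖ ^ b ≤ 1)
    (hint : ∀ y ∈ M, Valued.v (pairing σ (!![H₂ 0 0, 0, H₂ 0 1; 0, h, 0; H₂ 1 0, 0, H₂ 1 1] : Matrix (Fin 3) (Fin 3) K) y y) ≤ 1)
    (hint' : ∀ y ∈ M', Valued.v (pairing σ (!![H₂ 0 0, 0, H₂ 0 1; 0, h, 0; H₂ 1 0, 0, H₂ 1 1] : Matrix (Fin 3) (Fin 3) K) y y) ≤ 1)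
    {B₂ : Submodule 𝒪[K] (Fin 2 → K)} {w₀ : Fin 2 → K} {x₀ x₀' : Fin 3 → K} {ε : Matrix (Fin 2) (Fin 2) K} {ξ : K}
    (hσξ : σ ξ = ξ) (hξ1 : Valued.v ξ = 1) (hξN : ¬ ∃ z : K, z * σ z = ξ)
    (hε : ∀ x y : Fin 2 → K, pairing σ H₂ (ε *ᵥ x) (ε *ᵥ y) = ξ * pairing σ H₂ x y)
    (γ₂ : GL (Fin 2) K) (hεγ : ε * (γ₂ : Matrix (Fin 2) (Fin 2) K) = (γ₂ : Matrix (Fin 2) (Fin 2) K) * ε) (u : GL (Fin 1) K) (m : ℕ)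
    (hum : Valued.v ((u : Matrix (Fin 1) (Fin 1) K) 0 0 - 1) ≤ Valued.v (ϖ ^ m))
    (hB : B₂.map ((Matrix.toLin' (!![1, 0; 0, 0; 0, 1] : Matrix (Fin 3) (Fin 2) K)).restrictScalars 𝒪[K]) =
      M ⊓ LinearMap.ker ((LinearMap.proj (1 : Fin 3) : (Fin 3 → K) →ₗ[K] K).restrictScalars 𝒪[K]))
    (hB' : (B₂.map ((Matrix.toLin' ε).restrictScalars 𝒪[K])).map ((Matrix.toLin' (!![1, 0; 0, 0; 0, 1] : Matrix (Fin 3) (Fin 2) K)).restrictScalars 𝒪[K]) =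
      M' ⊓ LinearMap.ker ((LinearMap.proj (1 : Fin 3) : (Fin 3 → K) →ₗ[K] K).restrictScalars 𝒪[K]))
    (hx₀ : x₀ ∈ M) (hx₀' : x₀' ∈ M') (hx₀1 : Valued.v (x₀ 1) * Valued.v ϖ ^ b = 1) (hx₀'1 : Valued.v (x₀' 1) * Valued.v ϖ ^ b = 1)
    (hprx : x₀ - Pi.single 1 (x₀ 1) = ![w₀ 0, 0, w₀ 1]) (hprx' : x₀' - Pi.single 1 (x₀' 1) = ![(ε *ᵥ w₀) 0, 0, (ε *ᵥ w₀) 1])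
    {c : K} (hσc : σ c = c) (hc1 : Valued.v c = 1) (hcN : ¬ ∃ z : K, z * σ z = c) :
    ({z : K | ∃ y ∈ M, Valued.v ((ϖ ^ m)⁻¹ * (z - pairing σ (!![H₂ 0 0, 0, H₂ 0 1; 0, h, 0; H₂ 1 0, 0, H₂ 1 1] : Matrix (Fin 3) (Fin 3) K) y
          ((((endoGL (γ₂, u) : GL (Fin 3) K) : Matrix (Fin 3) (Fin 3) K) - 1) *ᵥ y))) ≤ 1} = valueSetMod σ ϖ m (xPlus σ ϖ d) →
      {z : K | ∃ y ∈ M', Valued.v ((ϖ ^ m)⁻¹ * (z - pairing σ (!![H₂ 0 0, 0, H₂ 0 1; 0, h, 0; H₂ 1 0, 0, H₂ 1 1] : Matrix (Fin 3) (Fin 3) K) y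
          ((((endoGL (γ₂, u) : GL (Fin 3) K) : Matrix (Fin 3) (Fin 3) K) - 1) *ᵥ y))) ≤ 1} = valueSetMod σ ϖ m (c • xPlus σ ϖ d)) ∧
    ({z : K | ∃ y ∈ M, Valued.v ((ϖ ^ m)⁻¹ * (z - pairing σ (!![H₂ 0 0, 0, H₂ 0 1; 0, h, 0; H₂ 1 0, 0, H₂ 1 1] : Matrix (Fin 3) (Fin 3) K) y
          ((((endoGL (γ₂, u) : GL (Fin 3) K) : Matrix (Fin 3) (Fin 3) K) - 1) *ᵥ y))) ≤ 1} = valueSetMod σ ϖ m (c • xPlus σ ϖ d) →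
      {z : K | ∃ y ∈ M', Valued.v ((ϖ ^ m)⁻¹ * (z - pairing σ (!![H₂ 0 0, 0, H₂ 0 1; 0, h, 0; H₂ 1 0, 0, H₂ 1 1] : Matrix (Fin 3) (Fin 3) K) y
          ((((endoGL (γ₂, u) : GL (Fin 3) K) : Matrix (Fin 3) (Fin 3) K) - 1) *ᵥ y))) ≤ 1} = valueSetMod σ ϖ m (xPlus σ ϖ d)) := by
  have hS' := valueSet_endoGL_sub_one_glued_map_eq_image_mul_of_v_sub_one_le σ hD.2.2.1 H₂ h hpr hpr' hint hint' hξ1 hε γ₂ hεγ u m hum hB hB' hx₀ hx₀' hx₀1 hx₀'1 hprx hprx'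
  refine ⟨fun hM => ?_, fun hM => ?_⟩
  · rw [hS']; exact image_mul_eq_valueSetMod_minus_of_eq_plus hD m hσξ hξ1 hξN hσc hc1 hcN hM
  · rw [hS']; exact image_mul_eq_valueSetMod_plus_of_eq_minus hD m hσξ hξ1 hξN hσc hc1 hcN hM

/-! ## §2 Census letters (`Φ₃ = block(antidiag₂, 1)`): the label classes `+ ↔ −′` are exchanged; the one-label form at the level of record -/

/-- **THE FACE NEAR 1, CENSUS LETTERS.**  Same frame at `(H₂, h) = (antidiag₂, 1)` (integrality for `Φ₃`): `LatticeLabelPlus M (Γ − 1) → latticeValueSetMod M′ (Γ − 1) = VS_m(c • X₊)`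
and `latticeValueSetMod M (Γ − 1) = VS_m(c • X₊) → LatticeLabelPlus M′ (Γ − 1)` (★ p861311 `latticeValueSetMod_glued_map_eq_image_mul_of_v_sub_one_le` ∘ ★ p861154 §3) — the vertex
over `ε·Λ` carries the OTHER class, on every cell near 1. [cite: Serre1979, Ch. V §3 Cor. 3] [cite: Rogawski1990, §4.9 Prop. 4.9.1 (b) p. 55] [cite: Kottwitz1986BaseChangeUnits, §1 pp. 240–241] -/
theorem latticeLabel_exchange_of_near_one [CompleteSpace K] [Finite 𝓀[K]] (hD : IsRamifiedQuadraticDatum σ ϖ d t)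
    {M M' : Submodule 𝒪[K] (Fin 3 → K)} {b : ℕ} (hpr : ∀ x ∈ M, Valued.v (x 1) * Valued.v ϖ ^ b ≤ 1) (hpr' : ∀ x ∈ M', Valued.v (x 1) * Valued.v ϖ ^ b ≤ 1)
    (hint : ∀ y ∈ M, Valued.v (pairing σ ((StdForm.antidiagonal 3).over K) y y) ≤ 1) (hint' : ∀ y ∈ M', Valued.v (pairing σ ((StdForm.antidiagonal 3).over K) y y) ≤ 1)
    {B₂ : Submodule 𝒪[K] (Fin 2 → K)} {w₀ : Fin 2 → K} {x₀ x₀' : Fin 3 → K} {ε : Matrix (Fin 2) (Fin 2) K} {ξ : K}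
    (hσξ : σ ξ = ξ) (hξ1 : Valued.v ξ = 1) (hξN : ¬ ∃ z : K, z * σ z = ξ)
    (hε : ∀ x y : Fin 2 → K, pairing σ ((StdForm.antidiagonal 2).over K) (ε *ᵥ x) (ε *ᵥ y) = ξ * pairing σ ((StdForm.antidiagonal 2).over K) x y)
    (γ₂ : GL (Fin 2) K) (hεγ : ε * (γ₂ : Matrix (Fin 2) (Fin 2) K) = (γ₂ : Matrix (Fin 2) (Fin 2) K) * ε) (u : GL (Fin 1) K) (m : ℕ)
    (hum : Valued.v ((u : Matrix (Fin 1) (Fin 1) K) 0 0 - 1) ≤ Valued.v (ϖ ^ m))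
    (hB : B₂.map ((Matrix.toLin' (!![1, 0; 0, 0; 0, 1] : Matrix (Fin 3) (Fin 2) K)).restrictScalars 𝒪[K]) =
      M ⊓ LinearMap.ker ((LinearMap.proj (1 : Fin 3) : (Fin 3 → K) →ₗ[K] K).restrictScalars 𝒪[K]))
    (hB' : (B₂.map ((Matrix.toLin' ε).restrictScalars 𝒪[K])).map ((Matrix.toLin' (!![1, 0; 0, 0; 0, 1] : Matrix (Fin 3) (Fin 2) K)).restrictScalars 𝒪[K]) =
      M' ⊓ LinearMap.ker ((LinearMap.proj (1 : Fin 3) : (Fin 3 → K) →ₗ[K] K).restrictScalars 𝒪[K]))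
    (hx₀ : x₀ ∈ M) (hx₀' : x₀' ∈ M') (hx₀1 : Valued.v (x₀ 1) * Valued.v ϖ ^ b = 1) (hx₀'1 : Valued.v (x₀' 1) * Valued.v ϖ ^ b = 1)
    (hprx : x₀ - Pi.single 1 (x₀ 1) = ![w₀ 0, 0, w₀ 1]) (hprx' : x₀' - Pi.single 1 (x₀' 1) = ![(ε *ᵥ w₀) 0, 0, (ε *ᵥ w₀) 1])
    {c : K} (hσc : σ c = c) (hc1 : Valued.v c = 1) (hcN : ¬ ∃ z : K, z * σ z = c) :
    (LatticeLabelPlus σ ϖ d m M (((endoGL (γ₂, u) : GL (Fin 3) K) : Matrix (Fin 3) (Fin 3) K) - 1) →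
        latticeValueSetMod σ ϖ m M' (((endoGL (γ₂, u) : GL (Fin 3) K) : Matrix (Fin 3) (Fin 3) K) - 1) = valueSetMod σ ϖ m (c • xPlus σ ϖ d)) ∧
      (latticeValueSetMod σ ϖ m M (((endoGL (γ₂, u) : GL (Fin 3) K) : Matrix (Fin 3) (Fin 3) K) - 1) = valueSetMod σ ϖ m (c • xPlus σ ϖ d) →
        LatticeLabelPlus σ ϖ d m M' (((endoGL (γ₂, u) : GL (Fin 3) K) : Matrix (Fin 3) (Fin 3) K) - 1)) := by
  have hS' := latticeValueSetMod_glued_map_eq_image_mul_of_v_sub_one_le σ hD.2.2.1 hpr hpr' hint hint' hξ1 hε γ₂ hεγ u m hum hB hB' hx₀ hx₀' hx₀1 hx₀'1 hprx hprx'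
  exact ⟨latticeValueSetMod_eq_minus_of_latticeLabelPlus_of_eq_image hD m hσξ hξ1 hξN hσc hc1 hcN hS',
    latticeLabelPlus_of_latticeValueSetMod_eq_minus_of_eq_image hD m hσξ hξ1 hξN hσc hc1 hcN hS'⟩

/-- **THE FACE NEAR 1, ONE-LABEL FORM AT THE LEVEL OF RECORD** (`m* = mstarOfRecord d`, so `hum` reads `|u₀₀ − 1| ≤ |ϖ^{m*}|`): given an (A″) witness at `M`
(`latticeValueSetMod M (Γ − 1) = VS_{m*}(e • X₊)` for some `σ`-fixed unit `e` — ★ p860337 on the clean shell), `LatticeLabelPlus M′ (Γ − 1) ↔ ¬ LatticeLabelPlus M (Γ − 1)`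
(★ p861311 scaling ∘ ★ p861154 `latticeLabelPlus_iff_not_of_eq_image`). [cite: Serre1979, Ch. V §3 Cor. 3] [cite: Rogawski1990, §4.9 Prop. 4.9.1 (b) p. 55] -/
theorem latticeLabelPlus_iff_not_of_near_one [CompleteSpace K] [Finite 𝓀[K]] (hD : IsRamifiedQuadraticDatum σ ϖ d t)
    {M M' : Submodule 𝒪[K] (Fin 3 → K)} {b : ℕ} (hpr : ∀ x ∈ M, Valued.v (x 1) * Valued.v ϖ ^ b ≤ 1) (hpr' : ∀ x ∈ M', Valued.v (x 1) * Valued.v ϖ ^ b ≤ 1)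
    (hint : ∀ y ∈ M, Valued.v (pairing σ ((StdForm.antidiagonal 3).over K) y y) ≤ 1) (hint' : ∀ y ∈ M', Valued.v (pairing σ ((StdForm.antidiagonal 3).over K) y y) ≤ 1)
    {B₂ : Submodule 𝒪[K] (Fin 2 → K)} {w₀ : Fin 2 → K} {x₀ x₀' : Fin 3 → K} {ε : Matrix (Fin 2) (Fin 2) K} {ξ : K}
    (hσξ : σ ξ = ξ) (hξ1 : Valued.v ξ = 1) (hξN : ¬ ∃ z : K, z * σ z = ξ)
    (hε : ∀ x y : Fin 2 → K, pairing σ ((StdForm.antidiagonal 2).over K) (ε *ᵥ x) (ε *ᵥ y) = ξ * pairing σ ((StdForm.antidiagonal 2).over K) x y)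
    (γ₂ : GL (Fin 2) K) (hεγ : ε * (γ₂ : Matrix (Fin 2) (Fin 2) K) = (γ₂ : Matrix (Fin 2) (Fin 2) K) * ε) (u : GL (Fin 1) K)
    (hum : Valued.v ((u : Matrix (Fin 1) (Fin 1) K) 0 0 - 1) ≤ Valued.v (ϖ ^ mstarOfRecord d))
    (hB : B₂.map ((Matrix.toLin' (!![1, 0; 0, 0; 0, 1] : Matrix (Fin 3) (Fin 2) K)).restrictScalars 𝒪[K]) =
      M ⊓ LinearMap.ker ((LinearMap.proj (1 : Fin 3) : (Fin 3 → K) →ₗ[K] K).restrictScalars 𝒪[K]))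
    (hB' : (B₂.map ((Matrix.toLin' ε).restrictScalars 𝒪[K])).map ((Matrix.toLin' (!![1, 0; 0, 0; 0, 1] : Matrix (Fin 3) (Fin 2) K)).restrictScalars 𝒪[K]) =
      M' ⊓ LinearMap.ker ((LinearMap.proj (1 : Fin 3) : (Fin 3 → K) →ₗ[K] K).restrictScalars 𝒪[K]))
    (hx₀ : x₀ ∈ M) (hx₀' : x₀' ∈ M') (hx₀1 : Valued.v (x₀ 1) * Valued.v ϖ ^ b = 1) (hx₀'1 : Valued.v (x₀' 1) * Valued.v ϖ ^ b = 1)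
    (hprx : x₀ - Pi.single 1 (x₀ 1) = ![w₀ 0, 0, w₀ 1]) (hprx' : x₀' - Pi.single 1 (x₀' 1) = ![(ε *ᵥ w₀) 0, 0, (ε *ᵥ w₀) 1])
    (hdich : ∃ e : K, σ e = e ∧ Valued.v e = 1 ∧
      latticeValueSetMod σ ϖ (mstarOfRecord d) M (((endoGL (γ₂, u) : GL (Fin 3) K) : Matrix (Fin 3) (Fin 3) K) - 1) = valueSetMod σ ϖ (mstarOfRecord d) (e • xPlus σ ϖ d)) :
    LatticeLabelPlus σ ϖ d (mstarOfRecord d) M' (((endoGL (γ₂, u) : GL (Fin 3) K) : Matrix (Fin 3) (Fin 3) K) - 1) ↔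
      ¬ LatticeLabelPlus σ ϖ d (mstarOfRecord d) M (((endoGL (γ₂, u) : GL (Fin 3) K) : Matrix (Fin 3) (Fin 3) K) - 1) :=
  latticeLabelPlus_iff_not_of_eq_image hD hσξ hξ1 hξN
    (latticeValueSetMod_glued_map_eq_image_mul_of_v_sub_one_le σ hD.2.2.1 hpr hpr' hint hint' hξ1 hε γ₂ hεγ u (mstarOfRecord d) hum hB hB' hx₀ hx₀' hx₀1 hx₀'1 hprx hprx')
    hdich

end Summit.HodgeConjecture.HodgeConjecture.Cruxes.H413.F0P3cDyRamGlueLabelExchangeNearOne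

end
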